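import Summits.QuantumFields.BalabanUV.Beta.FP.AveragingJetLettersBounds

/-!
# `Beta/FP/AveragingJetLettersSecond` — road «FP» (binder row D1), row **RHOA-6b** (part 3 of 3): the SECOND
# averaging jet `Q̈` in ORDERED NESTED kernel form `q̈(y; b″, b′; b)·[β_{b″},[β_{b′},φ_b]]` (Jacobi regrouping of node 6's
# `[S,[S,·]] + [C,·]`) and its letters (RHOA-DESIGN v1.1 §2bis, verbatim: «(q̈) likewise `n⁻³` per ordered pair of
# insertions, support collinear of length `< n` (ONE-dimensional)»)

HONEST FRAMING (cell `pub-balaban`, β sub-cell, verbatim): discharging `BetaPertH` makes Bałaban's UV stability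
UNCONDITIONAL — a real constructive-QFT result; it is NOT the continuum limit and NOT the Clay problem.  THIS MODULE
discharges NOTHING of the series, of row D1, of `hbook`/`hasym`/ρ: [folklore] non-commutative polynomial algebra and
finite counting on `ℤ⁴` for the cell's OWN averaging model ([our object] of part 1).  «not in print; our bookkeeping».
HONEST DEPENDENCY: continuum YM on T⁴ ⇐ BetaPertH ∧ nine spine estimates (0/9 proved); BetaPertH ⇐ (D1) ∧ (D4) ∧
CAP+tail; G-an2-4 gates asym, D1 and NE2/3/4.

ABSOLUTE RULE (cell charter, verbatim): «No internally-minted statement may enter as a cited fact. Every hypothesis is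
either kernel-proved in this package or a verbatim quotation of a PUBLISHED theorem with page reference. The
manuscript(s) under audit are NOT citable for their own disputed steps — they are the thing under adjudication;
programme-internal (2001/route/tribunal) claims are never citable.»  No `def … : Prop`, no citation, 0 sorry.

WHAT IS TYPED (objects of parts 1–2 BY NAME; `dc a b A := a·(b·A − A·b) − (b·A − A·b)·a = [a,[b,A]]`):
* §1 PER-CONTOUR ALGEBRA (any normed ring, as node 2's `commSum`): for letters `g 0, …, g (s−1)` in path order, `S = Σ_{i<s} g i`,
  `C = commSum = Σ_{i<j<s}[g i, g j]` (`commSum_map_range`): **`nested_form`**: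
  `[S,[S,A]] + [C,A] = Σ_{j<s} Σ_{i≤j} w(i,j) • [g i,[g j,A]]`, `w = 1` on the diagonal, `2` off it — the OUTER letter
  is the one met FIRST along the contour (nearer the block point); proof by induction on `s` with the Jacobi identity
  `[[S,g],A] = [S,[g,A]] − [g,[S,A]]` (`noncomm_ring`).
* §2 KERNEL FORM: `ddotIdx n` (quadruples `(((x′,s),j),i)`, `i ≤ j < s < n`), `ddotMap` (↦ `(b″, b′, b)` = outer
  insertion, inner insertion, field bond), weight `wt = 1∣2`, `ddotW n μ y b″ b′ b := Σ_{fibre} wt`,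
  `qddot := ddotW/n⁵ ≥ 0`, **`axialJet₂_eq_sum_qddot`**:
  `axialJet₂ n μ β φ y = Σ_{b″,b′,b ∈ ctrPts n μ y} qddot n μ y b″ b′ b • dc (β b″) (β b′) (φ b)`.
* §3 LETTERS (every finite `S` of blocks, `T` of bonds): (L3-0) `ddotW_ne_zero_imp` — support `b′ = b″ + r•e_μ`,
  `b = b″ + t•e_μ`, `r < t < n` (one contour: ONE-dimensional, length `< n`), all three points in `ctrPts n μ y`;
  (L3-1) `sum_ddotW_le` (`Σ_{y∈S} ddotW ≤ 2n`), **`sum_qddot_le`** (`Σ_{y∈S} q̈ ≤ 2/n⁴`); (L3-2) per ORDERED PAIR of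
  insertions `(b″, b′)`: `sum_sum_ddotW_le` (`Σ_{y∈S}Σ_{b∈T} ddotW ≤ 2·#triPairs n`), **`sum_sum_qddot_le`**
  (`Σ_{y∈S}Σ_{b∈T} q̈(y; b″, b′; b) ≤ 1/n³`).  Mechanism as in part 2: the position labels `i` / `(i, s)` are injective.
-/

noncomputable section

namespace Summit.QuantumFields.BalabanUV.Beta.FP.AveragingJetLettersSecond

open Finset
open scoped BigOperators
open Literature.MathematicalPhysics.QuantumFieldTheory.Balaban1983to89.Beta
open Literature.MathematicalPhysics.QuantumFieldTheory.Balaban1983to89.Beta.DyadicShell (Pt)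
open Literature.MathematicalPhysics.QuantumFieldTheory.Balaban1983to89.Beta.BubbleTransfer (unitVec)
open Literature.MathematicalPhysics.QuantumFieldTheory.Balaban1983to89.Beta.AxialBlockWeights (fineBlock idx pt)
open Literature.MathematicalPhysics.QuantumFieldTheory.Balaban1983to89.Beta.TransportVertices (commSum commSum_nil)
open Literature.MathematicalPhysics.QuantumFieldTheory.Balaban1983to89.Beta.AdjointTransportJets
  (commSum_append_singleton)
open Summit.QuantumFields.BalabanUV.Beta.FP.AveragingJetLetters
open Summit.QuantumFields.BalabanUV.Beta.FP.AveragingJetLettersBounds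

/-! ## §1 Per-contour algebra: the ordered nested form of `[S,[S,A]] + [C,A]` -/

section Algebra

variable {𝔸 : Type*} [NormedRing 𝔸]

/-- [folklore] the nested double commutator `[a,[b,A]]`. -/
def dc (a b A : 𝔸) : 𝔸 := a * (b * A - A * b) - (b * A - A * b) * a

/-- [folklore] the ordered commutator sum of a path with one more letter at the END. -/
theorem commSum_map_range_succ (g : ℕ → 𝔸) (s : ℕ) :
    commSum ((List.range (s + 1)).map g) = commSum ((List.range s).map g)
      + ((∑ i ∈ range s, g i) * g s - g s * ∑ i ∈ range s, g i) := by
  rw [List.range_succ, List.map_append, List.map_singleton, commSum_append_singleton, list_sum_map_range]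

/-- [folklore] the weighted last step: `Σ_{i<j+1} w(i,j)•F i = F j + Σ_{i<j} 2•F i`. -/
theorem sum_range_succ_wt {M : Type*} [AddCommMonoid M] (F : ℕ → M) (j : ℕ) :
    ∑ i ∈ range (j + 1), (if i = j then 1 else 2) • F i = F j + ∑ i ∈ range j, 2 • F i := by
  rw [Finset.sum_range_succ, if_pos rfl, one_nsmul, add_comm]
  congr 1
  refine Finset.sum_congr rfl fun i hi => ?_
  rw [if_neg (by have := mem_range.mp hi; omega)]

/-- THE ORDERED NESTED FORM (per contour): `[S,[S,A]] + [C,A] = Σ_{j<s} Σ_{i≤j} w(i,j)•[g i,[g j,A]]` with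
`S = Σ_{i<s} g i`, `C = commSum [g 0, …, g (s−1)]`, `w = 1` on the diagonal and `2` off it. [folklore] -/
theorem nested_form (g : ℕ → 𝔸) (A : 𝔸) (s : ℕ) :
    (((List.range s).map g).sum * (((List.range s).map g).sum * A - A * ((List.range s).map g).sum)
        - (((List.range s).map g).sum * A - A * ((List.range s).map g).sum) * ((List.range s).map g).sum)
      + (commSum ((List.range s).map g) * A - A * commSum ((List.range s).map g))
      = ∑ j ∈ range s, ∑ i ∈ range (j + 1), (if i = j then 1 else 2) • dc (g i) (g j) A := by
  induction s with
  | zero => simp [dc]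
  | succ s ih =>
    rw [Finset.sum_range_succ, ← ih, sum_range_succ_wt, commSum_map_range_succ, list_sum_map_range,
      list_sum_map_range, Finset.sum_range_succ]
    have h2 : ∑ i ∈ range s, 2 • dc (g i) (g s) A
        = 2 • ((∑ i ∈ range s, g i) * (g s * A - A * g s) - (g s * A - A * g s) * ∑ i ∈ range s, g i) := by
      rw [← Finset.smul_sum, dc_sum]
    rw [h2, dc, two_smul]
    noncomm_ring
  where
  /-- [folklore] `Σ_i [g i,[b,A]] = [Σ_i g i,[b,A]]`. -/
  dc_sum : ∀ (s : ℕ) (b : 𝔸), ∑ i ∈ range s, dc (g i) b A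
      = (∑ i ∈ range s, g i) * (b * A - A * b) - (b * A - A * b) * ∑ i ∈ range s, g i := by
    intro s b
    simp only [dc]
    rw [Finset.sum_sub_distrib, Finset.sum_mul, Finset.mul_sum]

end Algebra

/-! ## §2 The kernel form of the second jet -/

/-- [our object] the (q̈) index set: a (q̇) triple `((x′,s), j)` and an OUTER insertion position `i ≤ j`. -/
def ddotIdx (n : ℕ) : Finset (((Pt × ℕ) × ℕ) × ℕ) := (dotIdx n ×ˢ range n).filter fun r => r.2 < r.1.2 + 1

/-- [our object] (outer insertion bond, inner insertion bond, field bond) of an index quadruple. -/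
def ddotMap (n : ℕ) (μ : Fin 4) (y : Pt) (r : ((Pt × ℕ) × ℕ) × ℕ) : Pt × Pt × Pt :=
  (n • y + pt μ (r.1.1.1, r.2), n • y + pt μ (r.1.1.1, r.1.2), n • y + pt μ r.1.1)

/-- [our object] the Jacobi weight: `1` for a repeated insertion bond, `2` for two distinct ones. -/
def wt (r : ((Pt × ℕ) × ℕ) × ℕ) : ℕ := if r.2 = r.1.2 then 1 else 2

/-- [our object] the fibre of `ddotMap` over a bond triple. -/
def ddotFiber (n : ℕ) (μ : Fin 4) (y : Pt) (bbb : Pt × Pt × Pt) : Finset (((Pt × ℕ) × ℕ) × ℕ) :=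
  (ddotIdx n).filter fun r => ddotMap n μ y r = bbb

/-- [our object] the weighted INTEGER KERNEL of the second jet. -/
def ddotW (n : ℕ) (μ : Fin 4) (y b'' b' b : Pt) : ℕ := ∑ r ∈ ddotFiber n μ y (b'', b', b), wt r

/-- [our object] THE KERNEL `q̈(y; b″, b′; b) = ddotW / n⁵`. -/
def qddot (n : ℕ) (μ : Fin 4) (y b'' b' b : Pt) : ℝ := (ddotW n μ y b'' b' b : ℝ) / (n : ℝ) ^ 5

/-- [folklore] `q̈ ≥ 0`. -/
theorem qddot_nonneg (n : ℕ) (μ : Fin 4) (y b'' b' b : Pt) : 0 ≤ qddot n μ y b'' b' b := by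
  unfold qddot; positivity

/-- [folklore] `wt ≤ 2`. -/
theorem wt_le_two (r : ((Pt × ℕ) × ℕ) × ℕ) : wt r ≤ 2 := by
  unfold wt; split_ifs <;> omega

/-- [folklore] membership in the (q̈) index set. -/
theorem mem_ddotIdx {n : ℕ} {r : ((Pt × ℕ) × ℕ) × ℕ} :
    r ∈ ddotIdx n ↔ (r.1.1 ∈ idx n ∧ r.1.2 < r.1.1.2) ∧ r.2 ≤ r.1.2 := by
  rw [ddotIdx, mem_filter, mem_product, mem_dotIdx, mem_range]
  constructor
  · rintro ⟨⟨h1, _⟩, h3⟩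
    exact ⟨h1, by omega⟩
  · rintro ⟨h1, h3⟩
    have := (mem_idx_iff.mp h1.1).2
    exact ⟨⟨h1, by omega⟩, by omega⟩

/-- [folklore] the sum «over (q̇) triples, then over outer positions `i ≤ j`» is a sum over `ddotIdx`. -/
theorem sum_dotIdx_sum_range_eq_sum_ddotIdx {M : Type*} [AddCommMonoid M] (n : ℕ)
    (f : ((Pt × ℕ) × ℕ) → ℕ → M) :
    ∑ p ∈ dotIdx n, ∑ i ∈ range (p.2 + 1), f p i = ∑ r ∈ ddotIdx n, f r.1 r.2 := by
  rw [ddotIdx, Finset.sum_filter, Finset.sum_product]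
  refine Finset.sum_congr rfl fun p hp => ?_
  have h := mem_dotIdx.mp hp
  have hs : p.2 + 1 ≤ n := by have := (mem_idx_iff.mp h.1).2; omega
  rw [← filter_lt_range hs, Finset.sum_filter]

/-- [folklore] `ddotMap` lands in `ctrPts³`. -/
theorem ddotMap_mem {n : ℕ} (μ : Fin 4) (y : Pt) {r : ((Pt × ℕ) × ℕ) × ℕ} (hr : r ∈ ddotIdx n) :
    ddotMap n μ y r ∈ ctrPts n μ y ×ˢ (ctrPts n μ y ×ˢ ctrPts n μ y) := by
  obtain ⟨⟨h1, h2⟩, h3⟩ := mem_ddotIdx.mp hr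
  have h1' := mem_idx_iff.mp h1
  refine Finset.mem_product.mpr ⟨?_, Finset.mem_product.mpr ⟨?_, ?_⟩⟩
  · exact Finset.mem_image.mpr ⟨(r.1.1.1, r.2), mem_idx_iff.mpr ⟨h1'.1, by omega⟩, rfl⟩
  · exact Finset.mem_image.mpr ⟨(r.1.1.1, r.1.2), mem_idx_iff.mpr ⟨h1'.1, by omega⟩, rfl⟩
  · exact Finset.mem_image.mpr ⟨r.1.1, h1, rfl⟩

section KernelForm

variable {𝔸 : Type*} [NormedRing 𝔸] [NormedAlgebra ℝ 𝔸]

/-- THE KERNEL FORM OF THE SECOND JET: `Q̈[β,β]φ(y) = Σ_{b″,b′,b} q̈(y; b″, b′; b)·[β_{b″},[β_{b′},φ_b]]` over the finite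
set `ctrPts n μ y` in each variable (outside which `q̈(y; ·)` vanishes). [folklore] -/
theorem axialJet₂_eq_sum_qddot (n : ℕ) (μ : Fin 4) (β φ : Pt → 𝔸) (y : Pt) :
    axialJet₂ n μ β φ y = ∑ b'' ∈ ctrPts n μ y, ∑ b' ∈ ctrPts n μ y, ∑ b ∈ ctrPts n μ y,
      qddot n μ y b'' b' b • dc (β b'') (β b') (φ b) := by
  classical
  -- step 1: per contour, node 6's form = the ordered nested form
  have h1 : axialJet₂ n μ β φ y = ∑ q ∈ idx n, ∑ j ∈ range q.2, ∑ i ∈ range (j + 1), ((n : ℝ) ^ 5)⁻¹ •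
      ((if i = j then 1 else 2) • dc (β (n • y + pt μ (q.1, i))) (β (n • y + pt μ (q.1, j))) (φ (n • y + pt μ q))) := by
    unfold axialJet₂ ctrLetters
    refine Finset.sum_congr rfl fun q _ => ?_
    rw [nested_form (fun j => β (n • y + pt μ (q.1, j))) (φ (n • y + pt μ q)) q.2, Finset.smul_sum]
    refine Finset.sum_congr rfl fun j _ => ?_
    rw [Finset.smul_sum]
  -- step 2: one sum over the (q̈) index set, weight `wt`, summand read through `ddotMap`
  have h2 : axialJet₂ n μ β φ y = ∑ r ∈ ddotIdx n, ((wt r : ℝ) * ((n : ℝ) ^ 5)⁻¹) •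
      dc (β (ddotMap n μ y r).1) (β (ddotMap n μ y r).2.1) (φ (ddotMap n μ y r).2.2) := by
    rw [h1, sum_idx_sum_range_eq_sum_dotIdx, sum_dotIdx_sum_range_eq_sum_ddotIdx]
    refine Finset.sum_congr rfl fun r _ => ?_
    rw [← Nat.cast_smul_eq_nsmul ℝ, smul_smul, mul_comm]
    rfl
  -- step 3: regroup over the fibres of `ddotMap`
  rw [h2, ← Finset.sum_fiberwise_of_maps_to (fun r hr => ddotMap_mem μ y hr), Finset.sum_product]
  refine Finset.sum_congr rfl fun b'' _ => ?_
  rw [Finset.sum_product]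
  refine Finset.sum_congr rfl fun b' _ => Finset.sum_congr rfl fun b _ => ?_
  have hconst : ∀ r ∈ (ddotIdx n).filter (fun r => ddotMap n μ y r = (b'', b', b)),
      ((wt r : ℝ) * ((n : ℝ) ^ 5)⁻¹) •
          dc (β (ddotMap n μ y r).1) (β (ddotMap n μ y r).2.1) (φ (ddotMap n μ y r).2.2)
        = ((wt r : ℝ) * ((n : ℝ) ^ 5)⁻¹) • dc (β b'') (β b') (φ b) := by
    intro r hr
    rw [(Finset.mem_filter.mp hr).2]
  rw [Finset.sum_congr rfl hconst, ← Finset.sum_smul, ← Finset.sum_mul, qddot, ddotW, ddotFiber, Nat.cast_sum,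
    div_eq_mul_inv]

end KernelForm

/-! ## §3 The letters of `q̈` -/

/-- (L3-0) SUPPORT: a nonzero `ddotW n μ y b″ b′ b` forces `b′ = b″ + r•e_μ`, `b = b″ + t•e_μ` with `r < t < n` (both
insertions and the field bond on ONE contour, length `< n`) and all three points among the block's contour points.
[folklore] -/
theorem ddotW_ne_zero_imp {n : ℕ} {μ : Fin 4} {y b'' b' b : Pt} (h : ddotW n μ y b'' b' b ≠ 0) :
    (∃ r t : ℕ, r < t ∧ t < n ∧ b' = b'' + (r : ℤ) • unitVec μ ∧ b = b'' + (t : ℤ) • unitVec μ) ∧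
      b'' ∈ ctrPts n μ y ∧ b' ∈ ctrPts n μ y ∧ b ∈ ctrPts n μ y := by
  obtain ⟨r, hr, _⟩ := Finset.exists_ne_zero_of_sum_ne_zero h
  rw [ddotFiber, mem_filter] at hr
  obtain ⟨hr, h3⟩ := hr
  have hmem := ddotMap_mem μ y hr
  rw [h3, Finset.mem_product, Finset.mem_product] at hmem
  obtain ⟨⟨h1, h2⟩, h4⟩ := mem_ddotIdx.mp hr
  have hs := (mem_idx_iff.mp h1).2
  simp only [ddotMap, Prod.mk.injEq] at h3
  obtain ⟨hb'', hb', hb⟩ := h3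
  refine ⟨⟨r.1.2 - r.2, r.1.1.2 - r.2, by omega, by omega, ?_, ?_⟩, hmem.1, hmem.2.1, hmem.2.2⟩
  · rw [← hb', ← hb'', add_assoc, ← pt_eq_pt_add r.1.1.1 h4]
  · rw [← hb, ← hb'', add_assoc, ← pt_eq_pt_add r.1.1.1 (by omega)]

/-- (L3-1 count) `Σ_{y∈S} ddotW n μ y b″ b′ b ≤ 2n`: the outer position `i` labels the summands injectively, each of
weight `≤ 2`. [folklore] -/
theorem sum_ddotW_le (n : ℕ) (μ : Fin 4) (b'' b' b : Pt) (S : Finset Pt) :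
    ∑ y ∈ S, ddotW n μ y b'' b' b ≤ 2 * n := by
  classical
  have hcard : (((S ×ˢ ddotIdx n).filter fun z => ddotMap n μ z.1 z.2 = (b'', b', b)).card) ≤ n := by
    calc _ ≤ (range n).card := by
          refine Finset.card_le_card_of_injOn (fun z => z.2.2) ?_ ?_
          · intro z hz
            rw [Finset.mem_coe, Finset.mem_filter, Finset.mem_product, mem_ddotIdx] at hz
            obtain ⟨⟨_, ⟨h1, h2⟩, h4⟩, _⟩ := hz
            have hs := (mem_idx_iff.mp h1).2
            simp only [Finset.coe_range, Set.mem_Iio]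
            omega
          · intro z₁ hz₁ z₂ hz₂ hi
            rw [Finset.mem_coe, Finset.mem_filter, Finset.mem_product, mem_ddotIdx] at hz₁ hz₂
            simp only [ddotMap, Prod.mk.injEq] at hz₁ hz₂
            obtain ⟨⟨_, ⟨h1, _⟩, _⟩, hb''₁, hb'₁, hb₁⟩ := hz₁
            obtain ⟨⟨_, ⟨h2, _⟩, _⟩, hb''₂, hb'₂, hb₂⟩ := hz₂
            simp only at hi
            have hbase : n • z₁.1 + pt μ (z₁.2.1.1.1, z₁.2.2) = n • z₂.1 + pt μ (z₂.2.1.1.1, z₁.2.2) := by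
              rw [hb''₁, hi, hb''₂]
            obtain ⟨hy, hx⟩ := base_unique (mem_idx_iff.mp h1).1 (mem_idx_iff.mp h2).1 hbase
            have hj : z₁.2.1.2 = z₂.2.1.2 := by
              have h' : pt μ (z₁.2.1.1.1, z₁.2.1.2) = pt μ (z₂.2.1.1.1, z₂.2.1.2) := by
                have := hb'₁.trans hb'₂.symm
                rw [hy] at this
                exact add_left_cancel this
              exact pt_pos_injective (q₁ := (z₁.2.1.1.1, z₁.2.1.2)) (q₂ := (z₂.2.1.1.1, z₂.2.1.2)) hx h'
            have hq : z₁.2.1.1 = z₂.2.1.1 := by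
              have h' : pt μ z₁.2.1.1 = pt μ z₂.2.1.1 := by
                have := hb₁.trans hb₂.symm
                rw [hy] at this
                exact add_left_cancel this
              exact Prod.ext hx (pt_pos_injective hx h')
            exact Prod.ext hy (Prod.ext (Prod.ext hq hj) hi)
      _ = n := Finset.card_range n
  calc ∑ y ∈ S, ddotW n μ y b'' b' b
      = ∑ z ∈ (S ×ˢ ddotIdx n).filter (fun z => ddotMap n μ z.1 z.2 = (b'', b', b)), wt z.2 := by
        rw [Finset.sum_filter, Finset.sum_product]
        refine Finset.sum_congr rfl fun y _ => ?_
        rw [ddotW, ddotFiber, Finset.sum_filter]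
    _ ≤ ∑ _z ∈ (S ×ˢ ddotIdx n).filter (fun z => ddotMap n μ z.1 z.2 = (b'', b', b)), 2 :=
        Finset.sum_le_sum fun z _ => wt_le_two z.2
    _ ≤ 2 * n := by rw [Finset.sum_const, smul_eq_mul, mul_comm]; exact Nat.mul_le_mul_left 2 hcard

/-- (L3-1) `Σ_{y∈S} q̈(y; b″, b′; b) ≤ 2/n⁴`. [folklore] -/
theorem sum_qddot_le {n : ℕ} (hn : 1 ≤ n) (μ : Fin 4) (b'' b' b : Pt) (S : Finset Pt) :
    ∑ y ∈ S, qddot n μ y b'' b' b ≤ 2 / (n : ℝ) ^ 4 := by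
  unfold qddot
  rw [← Finset.sum_div, ← Nat.cast_sum]
  have hn0 : (0 : ℝ) < n := by exact_mod_cast hn
  rw [div_le_div_iff₀ (by positivity) (by positivity)]
  calc ((∑ y ∈ S, ddotW n μ y b'' b' b : ℕ) : ℝ) * (n : ℝ) ^ 4 ≤ (2 * n : ℕ) * (n : ℝ) ^ 4 := by
        gcongr
        exact_mod_cast sum_ddotW_le n μ b'' b' b S
    _ = 2 * (n : ℝ) ^ 5 := by push_cast; ring

/-- (L3-2 count, ordered insertion pair `(b″, b′)` fixed) `Σ_{y∈S} Σ_{b∈T} ddotW n μ y b″ b′ b ≤ 2·#triPairs n`: the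
position pair `(i, s)` (outer insertion, field bond) labels the summands injectively. [folklore] -/
theorem sum_sum_ddotW_le (n : ℕ) (μ : Fin 4) (b'' b' : Pt) (S T : Finset Pt) :
    ∑ y ∈ S, ∑ b ∈ T, ddotW n μ y b'' b' b ≤ 2 * (triPairs n).card := by
  classical
  set D := ((S ×ˢ T) ×ˢ ddotIdx n).filter fun z => ddotMap n μ z.1.1 z.2 = (b'', b', z.1.2) with hD
  have hcard : D.card ≤ (triPairs n).card := by
    refine Finset.card_le_card_of_injOn (fun z => (z.2.2, z.2.1.1.2)) ?_ ?_
    · intro z hz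
      rw [hD, Finset.mem_coe, Finset.mem_filter, Finset.mem_product, mem_ddotIdx] at hz
      obtain ⟨⟨_, ⟨h1, h2⟩, h4⟩, _⟩ := hz
      have hs := (mem_idx_iff.mp h1).2
      simp only [triPairs, Finset.coe_filter, Set.mem_setOf_eq, Finset.mem_product, Finset.mem_range]
      omega
    · intro z₁ hz₁ z₂ hz₂ his
      rw [hD, Finset.mem_coe, Finset.mem_filter, Finset.mem_product, mem_ddotIdx] at hz₁ hz₂
      simp only [ddotMap, Prod.mk.injEq] at hz₁ hz₂ his
      obtain ⟨⟨_, ⟨h1, _⟩, _⟩, hb''₁, hb'₁, hb₁⟩ := hz₁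
      obtain ⟨⟨_, ⟨h2, _⟩, _⟩, hb''₂, hb'₂, hb₂⟩ := hz₂
      obtain ⟨hi, hs⟩ := his
      have hbase : n • z₁.1.1 + pt μ (z₁.2.1.1.1, z₁.2.2) = n • z₂.1.1 + pt μ (z₂.2.1.1.1, z₁.2.2) := by
        rw [hb''₁, hi, hb''₂]
      obtain ⟨hy, hx⟩ := base_unique (mem_idx_iff.mp h1).1 (mem_idx_iff.mp h2).1 hbase
      have hj : z₁.2.1.2 = z₂.2.1.2 := by
        have h' : pt μ (z₁.2.1.1.1, z₁.2.1.2) = pt μ (z₂.2.1.1.1, z₂.2.1.2) := by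
          have := hb'₁.trans hb'₂.symm
          rw [hy] at this
          exact add_left_cancel this
        exact pt_pos_injective (q₁ := (z₁.2.1.1.1, z₁.2.1.2)) (q₂ := (z₂.2.1.1.1, z₂.2.1.2)) hx h'
      have hq : z₁.2.1.1 = z₂.2.1.1 := Prod.ext hx hs
      have hb : z₁.1.2 = z₂.1.2 := by rw [← hb₁, ← hb₂, hy, hq]
      exact Prod.ext (Prod.ext hy hb) (Prod.ext (Prod.ext hq hj) hi)
  calc ∑ y ∈ S, ∑ b ∈ T, ddotW n μ y b'' b' b = ∑ z ∈ D, wt z.2 := by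
        rw [hD, Finset.sum_filter, Finset.sum_product, Finset.sum_product]
        refine Finset.sum_congr rfl fun y _ => Finset.sum_congr rfl fun b _ => ?_
        rw [ddotW, ddotFiber, Finset.sum_filter]
    _ ≤ ∑ _z ∈ D, 2 := Finset.sum_le_sum fun z _ => wt_le_two z.2
    _ ≤ 2 * (triPairs n).card := by
        rw [Finset.sum_const, smul_eq_mul, mul_comm]; exact Nat.mul_le_mul_left 2 hcard

/-- (L3-2) THE SECOND-JET OPERATOR-NORM LETTER per ORDERED PAIR of insertions (the row's «(q̈) likewise `n⁻³` per
ordered pair of insertions»): `Σ_{y∈S} Σ_{b∈T} q̈(y; b″, b′; b) ≤ 1/n³`. [folklore] -/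
theorem sum_sum_qddot_le {n : ℕ} (hn : 1 ≤ n) (μ : Fin 4) (b'' b' : Pt) (S T : Finset Pt) :
    ∑ y ∈ S, ∑ b ∈ T, qddot n μ y b'' b' b ≤ 1 / (n : ℝ) ^ 3 := by
  have h : ∑ y ∈ S, ∑ b ∈ T, qddot n μ y b'' b' b
      = ((∑ y ∈ S, ∑ b ∈ T, ddotW n μ y b'' b' b : ℕ) : ℝ) / (n : ℝ) ^ 5 := by
    rw [Nat.cast_sum, Finset.sum_div]
    refine Finset.sum_congr rfl fun y _ => ?_
    rw [Nat.cast_sum, Finset.sum_div]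
    rfl
  rw [h]
  have hn0 : (0 : ℝ) < n := by exact_mod_cast hn
  have h1 : ((∑ y ∈ S, ∑ b ∈ T, ddotW n μ y b'' b' b : ℕ) : ℝ) ≤ 2 * ((n : ℝ) ^ 2 / 2) :=
    (by exact_mod_cast sum_sum_ddotW_le n μ b'' b' S T :
      ((∑ y ∈ S, ∑ b ∈ T, ddotW n μ y b'' b' b : ℕ) : ℝ) ≤ 2 * ((triPairs n).card : ℝ)).trans
      (by have := card_triPairs_le n; linarith)
  rw [div_le_div_iff₀ (by positivity) (by positivity)]
  calc ((∑ y ∈ S, ∑ b ∈ T, ddotW n μ y b'' b' b : ℕ) : ℝ) * (n : ℝ) ^ 3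
      ≤ 2 * ((n : ℝ) ^ 2 / 2) * (n : ℝ) ^ 3 := by gcongr
    _ = 1 * (n : ℝ) ^ 5 := by ring

end Summit.QuantumFields.BalabanUV.Beta.FP.AveragingJetLettersSecond

end
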